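import Summits.HodgeConjecture.CorCM.AbelianOddPartSignSets
import HarnessLib

/-!
# The two atoms through complex conjugation of a non-cyclic abelian Galois group with an odd part:
# `ℤ/2 × (ℤ/p × ℤ/p)` (vanishing sums, NOT of Weil type) and `ℤ/2 × (ℤ/2 × ℤ/n)` (balanced)

COR-CM (cell `pub-hodgecm2`), binder seat b04 (gen 18), count-neutral claim ABELIAN-ODD-PART, part IIb.
KERNEL ONLY: theorems; no definition, no named fact, no `sorry`.  `HC_CM` is neither used nor claimed.

Both atoms are SIGN SETS `T_N = {(i, x) : i = 1 ↔ x ∈ N} ⊆ ℤ/2 × X` (part IIa), `c₀ = (1, 0)`; the parameters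
`p, n ≥ 3` are symbolic, so everything is proved structurally (no `decide`).

* §1 **Atom A**, `X = ℤ/p × ℤ/p` (`p ≥ 3`; in part III `p` is an odd prime and `X = ⟨u⟩ × ⟨v⟩` for two
  independent Galois automorphisms of order `p`).  `N₀ = {(0, 1)} ∪ {(a, 0) : a ≠ 0}` — the graph of the
  indicator function of `0` — is a transversal of the line `{a = 0}` which is not a coset of a subgroup, so `N₀`
  is invariant under no non-zero translation (`atomA_ha`) and no translate of it is its complement or the line
  `N₁ = {b = 0}` or the complement of `N₁` (`atomA_hb`, `atomA_ha'`, `atomA_hb'`: here `p ≥ 3` enters as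
  `|N| = p < p² − p`).  For a character `χ` with `χ(c₀) = −1`, `χ(0,(1,0)) ≠ 1`, `χ(0,(0,1)) = 1` the sums over
  the graphs `N₀`, `N₁` are `Σ_a χ(0,(a,0)) = 0` (`sum_graph_eq_zero`), so `T_{N₀}`, `T_{N₁}` are killed by `χ`
  (vanishing-sum mechanism `1 + ζ_p + ⋯ + ζ_p^{p−1} = 0`): **`atomA`**.  Every subgroup of `ℤ/2 × X` avoiding
  `c₀` has odd order, so these degenerate CM sets are balanced over NO subgroup — not of Weil type.
* §2 **Atom B**, `X = ℤ/2 × ℤ/n` (`n ≥ 3`; in part III `X = ⟨t⟩ × ⟨u⟩`, `t ≠ c` a second involution, `u` of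
  odd prime order).  `N₀ = {(0, −1)} ∪ {(1, k) : k ≠ 0}` (`n` points: `atomB_card`), `N₁ = {(1, k)}`; the four
  translation conditions (`atomB_ha/hb/ha'/hb'`, `n ≥ 3` enters through `k ∉ {0, −1−τ}` and `1 ≠ −1`); a
  character with `χ(c₀) = −1` trivial on `X` kills both (balanced mechanism, Weil type over the fixed field of
  `X`): **`atomB`**.

## References

* [Kubota1965] T. Kubota, *On the field extension by complex multiplication*, Trans. AMS 118 (1965), §4 Lemma 2.
* [Shimura1998] G. Shimura, *Abelian Varieties with Complex Multiplication and Modular Functions*, §8.1, §8.2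
  Prop. 26.
* [Gordon1999HodgeAVSurvey] B. B. Gordon, *A survey of the Hodge conjecture for abelian varieties*, §9.4.2,
  §9.4.3.
* [Dodson1984] B. Dodson, *The structure of Galois groups of CM-fields*, Trans. AMS 283 (1984), §3.2.1.
-/

noncomputable section

namespace Summit.HodgeConjecture.CorCM.AbelianOddPart

open Summit.HodgeConjecture.CorCM.TwoGroupPieces (zmod_two_cases)

open scoped Classical

/-! ## §0 Small facts on `ℤ/n`, `n ≥ 3` -/

section ZModFacts

variable {n : ℕ}

/-- `(2 : ℤ/n) ≠ 0` for `n ≥ 3`. [folklore] -/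
theorem zmod_two_ne_zero (hn : 3 ≤ n) : (2 : ZMod n) ≠ 0 := by
  intro h
  have h2 : ((2 : ℕ) : ZMod n) = 0 := by exact_mod_cast h
  rw [ZMod.natCast_eq_zero_iff] at h2
  exact absurd (Nat.le_of_dvd two_pos h2) (by omega)

/-- `(1 : ℤ/n) ≠ 0` for `n ≥ 3`. [folklore] -/
theorem zmod_one_ne_zero (hn : 3 ≤ n) : (1 : ZMod n) ≠ 0 := by
  intro h
  have h1 : ((1 : ℕ) : ZMod n) = 0 := by exact_mod_cast h
  rw [ZMod.natCast_eq_zero_iff] at h1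
  exact absurd (Nat.le_of_dvd one_pos h1) (by omega)

/-- `(-1 : ℤ/n) ≠ 0` for `n ≥ 3`. [folklore] -/
theorem zmod_neg_one_ne_zero (hn : 3 ≤ n) : (-1 : ZMod n) ≠ 0 :=
  neg_ne_zero.2 (zmod_one_ne_zero hn)

/-- `(1 : ℤ/n) ≠ -1` for `n ≥ 3`. [folklore] -/
theorem zmod_one_ne_neg_one (hn : 3 ≤ n) : (1 : ZMod n) ≠ -1 := by
  intro h
  apply zmod_two_ne_zero hn
  have h2 : (2 : ZMod n) = 1 + 1 := by norm_num
  rw [h2]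
  nth_rewrite 1 [h]
  rw [neg_add_cancel]

/-- In `ℤ/n`, `n ≥ 3`, there is an element avoiding two given ones. [folklore] -/
theorem zmod_exists_ne_ne (hn : 3 ≤ n) (r s : ZMod n) : ∃ b : ZMod n, b ≠ r ∧ b ≠ s := by
  haveI : NeZero n := ⟨by omega⟩
  have hlt : ({r, s} : Finset (ZMod n)).card < (Finset.univ : Finset (ZMod n)).card := by
    rw [Finset.card_univ, ZMod.card]
    exact lt_of_le_of_lt (Finset.card_le_two) (by omega)
  obtain ⟨b, -, hb⟩ := Finset.exists_mem_notMem_of_card_lt_card hlt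
  simp only [Finset.mem_insert, Finset.mem_singleton, not_or] at hb
  exact ⟨b, hb.1, hb.2⟩

end ZModFacts

/-! ## §1 Atom A: `X = ℤ/p × ℤ/p`, `N₀ = {(0,1)} ∪ {(a,0) : a ≠ 0}`, `N₁ = {(a,0)}` -/

section AtomA

variable {p : ℕ}

/-- Atom A: `N₀` is invariant under no non-zero translation. [cite: Shimura1998, §8.2 Prop. 26] -/
theorem atomA_ha (hp : 3 ≤ p) {N₀ : Finset (ZMod p × ZMod p)}
    (hN₀ : ∀ x : ZMod p × ZMod p, x ∈ N₀ ↔ x.2 = if x.1 = 0 then 1 else 0) :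
    ∀ x₀ : ZMod p × ZMod p, x₀ ≠ 0 → ∃ y : ZMod p × ZMod p, ¬ (y ∈ N₀ ↔ x₀ + y ∈ N₀) := by
  rintro ⟨α, β⟩ hx₀
  by_cases hα : α = 0
  · subst hα
    have hβ : β ≠ 0 := fun h => hx₀ (by rw [h]; rfl)
    refine ⟨(0, 1), fun h => ?_⟩
    simp only [hN₀, Prod.mk_add_mk, add_zero, if_true, true_iff] at h
    exact hβ (by simpa using h)
  · by_cases hβ : β = 1
    · subst hβ
      refine ⟨(0, 1), fun h => ?_⟩
      simp only [hN₀, Prod.mk_add_mk, add_zero, if_true, true_iff, hα, if_false] at h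
      exact zmod_two_ne_zero hp (by rw [show (2 : ZMod p) = 1 + 1 by norm_num]; exact h)
    · refine ⟨(-α, 0), fun h => ?_⟩
      simp only [hN₀, Prod.mk_add_mk, add_zero, add_neg_cancel, if_true, neg_eq_zero, hα, if_false,
        true_iff] at h
      exact hβ h

/-- Atom A: no translate of `N₀` is the complement of `N₀` (`p ≥ 3`). [cite: Shimura1998, §8.2 Prop. 26] -/
theorem atomA_hb (hp : 3 ≤ p) {N₀ : Finset (ZMod p × ZMod p)}
    (hN₀ : ∀ x : ZMod p × ZMod p, x ∈ N₀ ↔ x.2 = if x.1 = 0 then 1 else 0) :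
    ∀ x₀ : ZMod p × ZMod p, ∃ y : ZMod p × ZMod p, (y ∈ N₀ ↔ x₀ + y ∈ N₀) := by
  rintro ⟨α, β⟩
  obtain ⟨b, hb1, hb2⟩ := zmod_exists_ne_ne hp 1 ((if α = 0 then 1 else 0) - β)
  refine ⟨(0, b), iff_of_false ?_ ?_⟩
  · simpa only [hN₀, if_true] using hb1
  · simp only [hN₀, Prod.mk_add_mk, add_zero]
    intro h
    exact hb2 (by rw [← h]; ring)

/-- Atom A: no translate of `N₀` is `N₁`. [cite: Shimura1998, §8.1] -/
theorem atomA_ha' (hp : 3 ≤ p) {N₀ N₁ : Finset (ZMod p × ZMod p)}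
    (hN₀ : ∀ x : ZMod p × ZMod p, x ∈ N₀ ↔ x.2 = if x.1 = 0 then 1 else 0)
    (hN₁ : ∀ x : ZMod p × ZMod p, x ∈ N₁ ↔ x.2 = 0) :
    ∀ x₀ : ZMod p × ZMod p, ∃ y : ZMod p × ZMod p, ¬ (y ∈ N₁ ↔ x₀ + y ∈ N₀) := by
  rintro ⟨α, β⟩
  by_cases hβ : β = 1
  · subst hβ
    refine ⟨(1 - α, 0), fun h => ?_⟩
    have h1 : α + (1 - α) ≠ 0 := by rw [add_sub_cancel]; exact zmod_one_ne_zero hp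
    simp only [hN₀, hN₁, Prod.mk_add_mk, add_zero, h1, if_false, true_iff] at h
    exact zmod_one_ne_zero hp h
  · refine ⟨(-α, 0), fun h => ?_⟩
    simp only [hN₀, hN₁, Prod.mk_add_mk, add_zero, add_neg_cancel, if_true, true_iff] at h
    exact hβ h

/-- Atom A: no translate of `N₀` is the complement of `N₁` (`p ≥ 3`). [cite: Shimura1998, §8.1] -/
theorem atomA_hb' (hp : 3 ≤ p) {N₀ N₁ : Finset (ZMod p × ZMod p)}
    (hN₀ : ∀ x : ZMod p × ZMod p, x ∈ N₀ ↔ x.2 = if x.1 = 0 then 1 else 0)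
    (hN₁ : ∀ x : ZMod p × ZMod p, x ∈ N₁ ↔ x.2 = 0) :
    ∀ x₀ : ZMod p × ZMod p, ∃ y : ZMod p × ZMod p, (y ∈ N₁ ↔ x₀ + y ∈ N₀) := by
  rintro ⟨α, β⟩
  obtain ⟨b, hb1, hb2⟩ := zmod_exists_ne_ne hp 0 ((if α = 0 then 1 else 0) - β)
  refine ⟨(0, b), iff_of_false ?_ ?_⟩
  · simpa only [hN₁] using hb1
  · simp only [hN₀, Prod.mk_add_mk, add_zero]
    intro h
    exact hb2 (by rw [← h]; ring)

/-- Atom A: the character sum over the GRAPH of any `d : ℤ/p → ℤ/p` vanishes when `χ(0,(1,0)) ≠ 1` and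
`χ(0,(0,1)) = 1`: `Σ_a χ(0,(a, d a)) = Σ_a χ(0,(a,0)) = 0` (`1 + ζ + ⋯ + ζ^{p−1} = 0`).
[cite: Kubota1965, §4 Lemma 2] -/
theorem sum_graph_eq_zero [NeZero p] (d : ZMod p → ZMod p) {N : Finset (ZMod p × ZMod p)}
    (hN : ∀ x : ZMod p × ZMod p, x ∈ N ↔ x.2 = d x.1) (χ : AddChar (ZMod 2 × (ZMod p × ZMod p)) ℂ)
    (hu : χ (0, (1, 0)) ≠ 1) (hv : χ (0, (0, 1)) = 1) : ∑ x ∈ N, χ (0, x) = 0 := by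
  have hNim : N = Finset.univ.image (fun a : ZMod p => (a, d a)) := by
    ext ⟨a, b⟩
    simp only [hN, Finset.mem_image, Finset.mem_univ, true_and, Prod.mk.injEq]
    constructor
    · rintro rfl
      exact ⟨a, rfl, rfl⟩
    · rintro ⟨a', rfl, rfl⟩
      rfl
  rw [hNim, Finset.sum_image fun a _ b _ h => (Prod.mk.inj h).1]
  simp_rw [addChar_zero_mk_eq_of_apply_eq_one χ hv]
  -- `a ↦ χ(0,(a,0))` is a non-trivial character of `ℤ/p`
  set ψ : AddChar (ZMod p) ℂ := χ.compAddMonoidHom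
    ((AddMonoidHom.inr (ZMod 2) (ZMod p × ZMod p)).comp (AddMonoidHom.inl (ZMod p) (ZMod p))) with hψ
  have hψx : ∀ a, ψ a = χ (0, (a, 0)) := fun a => by
    rw [hψ, AddChar.compAddMonoidHom_apply, AddMonoidHom.comp_apply, AddMonoidHom.inl_apply,
      AddMonoidHom.inr_apply]
  have hψ0 : ψ ≠ 0 := fun h => hu (by rw [← hψx, h, AddChar.zero_apply])
  have hsum := AddChar.sum_eq_zero_iff_ne_zero.2 hψ0
  simp_rw [hψx] at hsum
  exact hsum

/-- **ATOM A.**  On `M = ℤ/2 × (ℤ/p × ℤ/p)`, `p ≥ 3`, with `c₀ = (1, 0)`: CM sets `T₀ = T_{N₀}`, `T₁ = T_{N₁}` for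
`c₀`, `T₀` with trivial stabiliser and not a translate of `T₁`, both killed by every character `χ` of `M` with
`χ(c₀) = −1`, `χ(0,(1,0)) ≠ 1`, `χ(0,(0,1)) = 1`.  These degenerate CM sets are NOT balanced over any subgroup
avoiding `c₀` (all such subgroups have odd order). [cite: Kubota1965, §4 Lemma 2] [cite: Shimura1998, §8.2
Prop. 26] [cite: Gordon1999HodgeAVSurvey, §9.4.2] -/
theorem atomA (hp : 3 ≤ p) :
    ∃ T₀ T₁ : Finset (ZMod 2 × (ZMod p × ZMod p)),
      (∀ m, m ∈ T₀ ↔ (1, 0) + m ∉ T₀) ∧ (∀ m, m ∈ T₁ ↔ (1, 0) + m ∉ T₁) ∧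
      (∀ v, v ≠ 0 → ∃ w, ¬ (w ∈ T₀ ↔ v + w ∈ T₀)) ∧ (∀ d, ∃ w, ¬ (w ∈ T₁ ↔ d + w ∈ T₀)) ∧
      ∀ χ : AddChar (ZMod 2 × (ZMod p × ZMod p)) ℂ, χ (1, 0) = -1 → χ (0, (1, 0)) ≠ 1 →
        χ (0, (0, 1)) = 1 → ∑ m ∈ T₀, χ m = 0 ∧ ∑ m ∈ T₁, χ m = 0 := by
  haveI : NeZero p := ⟨by omega⟩
  set N₀ : Finset (ZMod p × ZMod p) :=
    Finset.univ.filter fun x => x.2 = if x.1 = 0 then 1 else 0 with hN₀_def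
  set N₁ : Finset (ZMod p × ZMod p) := Finset.univ.filter fun x => x.2 = 0 with hN₁_def
  have hN₀ : ∀ x : ZMod p × ZMod p, x ∈ N₀ ↔ x.2 = if x.1 = 0 then 1 else 0 := fun x => by
    simp only [hN₀_def, Finset.mem_filter, Finset.mem_univ, true_and]
  have hN₁ : ∀ x : ZMod p × ZMod p, x ∈ N₁ ↔ x.2 = 0 := fun x => by
    simp only [hN₁_def, Finset.mem_filter, Finset.mem_univ, true_and]
  set T₀ : Finset (ZMod 2 × (ZMod p × ZMod p)) := Finset.univ.filter fun m => (m.1 = 1 ↔ m.2 ∈ N₀)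
    with hT₀_def
  set T₁ : Finset (ZMod 2 × (ZMod p × ZMod p)) := Finset.univ.filter fun m => (m.1 = 1 ↔ m.2 ∈ N₁)
    with hT₁_def
  have hT₀ : ∀ m, m ∈ T₀ ↔ (m.1 = 1 ↔ m.2 ∈ N₀) := fun m => by
    simp only [hT₀_def, Finset.mem_filter, Finset.mem_univ, true_and]
  have hT₁ : ∀ m, m ∈ T₁ ↔ (m.1 = 1 ↔ m.2 ∈ N₁) := fun m => by
    simp only [hT₁_def, Finset.mem_filter, Finset.mem_univ, true_and]
  refine ⟨T₀, T₁, signSet_cm hT₀, signSet_cm hT₁, signSet_prim hT₀ (atomA_ha hp hN₀) (atomA_hb hp hN₀),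
    signSet_ntr hT₀ hT₁ (atomA_ha' hp hN₀ hN₁) (atomA_hb' hp hN₀ hN₁), fun χ hc hu hv => ⟨?_, ?_⟩⟩
  · exact sum_signSet_eq_zero_of_sum_eq_zero hT₀ χ hc hu
      (sum_graph_eq_zero (fun a : ZMod p => if a = 0 then (1 : ZMod p) else 0) hN₀ χ hu hv)
  · exact sum_signSet_eq_zero_of_sum_eq_zero hT₁ χ hc hu
      (sum_graph_eq_zero (fun _ : ZMod p => (0 : ZMod p)) hN₁ χ hu hv)

end AtomA

/-! ## §2 Atom B: `X = ℤ/2 × ℤ/n`, `N₀ = {(0,−1)} ∪ {(1,k) : k ≠ 0}`, `N₁ = {(1,k)}` -/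

section AtomB

variable {n : ℕ}

/-- Atom B: `N₀` is invariant under no non-zero translation (`n ≥ 3`). [cite: Shimura1998, §8.2 Prop. 26] -/
theorem atomB_ha (hn : 3 ≤ n) {N₀ : Finset (ZMod 2 × ZMod n)}
    (hN₀ : ∀ x : ZMod 2 × ZMod n, x ∈ N₀ ↔ (x.1 = 0 ∧ x.2 = -1) ∨ (x.1 = 1 ∧ x.2 ≠ 0)) :
    ∀ x₀ : ZMod 2 × ZMod n, x₀ ≠ 0 → ∃ y : ZMod 2 × ZMod n, ¬ (y ∈ N₀ ↔ x₀ + y ∈ N₀) := by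
  have h01 : ((0 : ZMod 2) = 1) ↔ False := by decide
  have h10 : ((1 : ZMod 2) = 0) ↔ False := by decide
  have h11 : (1 : ZMod 2) + 1 = 0 := by decide
  rintro ⟨δ, τ⟩ hx₀
  rcases zmod_two_cases δ with rfl | rfl
  · have hτ : τ ≠ 0 := fun h => hx₀ (by rw [h]; rfl)
    refine ⟨(0, -1), fun h => ?_⟩
    simp only [hN₀, Prod.mk_add_mk, add_zero, h01, false_and, or_false, true_and] at h
    exact hτ (by simpa using h)
  · obtain ⟨k, hk0, hk1⟩ := zmod_exists_ne_ne hn 0 (-1 - τ)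
    refine ⟨(1, k), fun h => ?_⟩
    simp only [hN₀, Prod.mk_add_mk, h11, h01, h10, false_and, or_false, false_or, true_and] at h
    exact hk1 (by rw [← h.1 hk0]; ring)

/-- Atom B: no translate of `N₀` is the complement of `N₀` (`n ≥ 3`). [cite: Shimura1998, §8.2 Prop. 26] -/
theorem atomB_hb (hn : 3 ≤ n) {N₀ : Finset (ZMod 2 × ZMod n)}
    (hN₀ : ∀ x : ZMod 2 × ZMod n, x ∈ N₀ ↔ (x.1 = 0 ∧ x.2 = -1) ∨ (x.1 = 1 ∧ x.2 ≠ 0)) :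
    ∀ x₀ : ZMod 2 × ZMod n, ∃ y : ZMod 2 × ZMod n, (y ∈ N₀ ↔ x₀ + y ∈ N₀) := by
  have h01 : ((0 : ZMod 2) = 1) ↔ False := by decide
  have h10 : ((1 : ZMod 2) = 0) ↔ False := by decide
  have h11 : (1 : ZMod 2) + 1 = 0 := by decide
  rintro ⟨δ, τ⟩
  rcases zmod_two_cases δ with rfl | rfl
  · obtain ⟨k, hk0, hk1⟩ := zmod_exists_ne_ne hn (-1) (-1 - τ)
    refine ⟨(0, k), iff_of_false ?_ ?_⟩
    · simp only [hN₀, h01, false_and, or_false, true_and]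
      exact hk0
    · simp only [hN₀, Prod.mk_add_mk, add_zero, h01, false_and, or_false, true_and]
      intro h
      exact hk1 (by rw [← h]; ring)
  · by_cases hτ : τ = 1
    · subst hτ
      refine ⟨(1, 0), iff_of_false ?_ ?_⟩
      · simp only [hN₀, h10, false_and, false_or, true_and, ne_eq, not_true_eq_false, not_false_eq_true]
      · simp only [hN₀, Prod.mk_add_mk, h11, add_zero, h01, false_and, or_false, true_and]
        exact zmod_one_ne_neg_one hn
    · refine ⟨(0, -τ), iff_of_false ?_ ?_⟩
      · simp only [hN₀, h01, false_and, or_false, true_and, neg_inj]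
        exact hτ
      · simp only [hN₀, Prod.mk_add_mk, add_zero, add_neg_cancel, h10, false_and, false_or, true_and, ne_eq,
          not_true_eq_false, not_false_eq_true]

/-- Atom B: no translate of `N₀` is `N₁`. [cite: Shimura1998, §8.1] -/
theorem atomB_ha' (hn : 3 ≤ n) {N₀ N₁ : Finset (ZMod 2 × ZMod n)}
    (hN₀ : ∀ x : ZMod 2 × ZMod n, x ∈ N₀ ↔ (x.1 = 0 ∧ x.2 = -1) ∨ (x.1 = 1 ∧ x.2 ≠ 0))
    (hN₁ : ∀ x : ZMod 2 × ZMod n, x ∈ N₁ ↔ x.1 = 1) :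
    ∀ x₀ : ZMod 2 × ZMod n, ∃ y : ZMod 2 × ZMod n, ¬ (y ∈ N₁ ↔ x₀ + y ∈ N₀) := by
  have h01 : ((0 : ZMod 2) = 1) ↔ False := by decide
  have h10 : ((1 : ZMod 2) = 0) ↔ False := by decide
  have h11 : (1 : ZMod 2) + 1 = 0 := by decide
  rintro ⟨δ, τ⟩
  refine ⟨(1, -τ), fun h => ?_⟩
  rw [hN₁] at h
  simp only [true_iff, hN₀, Prod.mk_add_mk, add_neg_cancel] at h
  rcases zmod_two_cases δ with rfl | rfl
  · simp only [zero_add, h10, false_and, false_or, true_and, ne_eq, not_true_eq_false] at h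
  · simp only [h11, true_and, h01, false_and, or_false] at h
    exact zmod_neg_one_ne_zero hn h.symm

/-- Atom B: no translate of `N₀` is the complement of `N₁`. [cite: Shimura1998, §8.1] -/
theorem atomB_hb' (hn : 3 ≤ n) {N₀ N₁ : Finset (ZMod 2 × ZMod n)}
    (hN₀ : ∀ x : ZMod 2 × ZMod n, x ∈ N₀ ↔ (x.1 = 0 ∧ x.2 = -1) ∨ (x.1 = 1 ∧ x.2 ≠ 0))
    (hN₁ : ∀ x : ZMod 2 × ZMod n, x ∈ N₁ ↔ x.1 = 1) :
    ∀ x₀ : ZMod 2 × ZMod n, ∃ y : ZMod 2 × ZMod n, (y ∈ N₁ ↔ x₀ + y ∈ N₀) := by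
  have h01 : ((0 : ZMod 2) = 1) ↔ False := by decide
  have h10 : ((1 : ZMod 2) = 0) ↔ False := by decide
  rintro ⟨δ, τ⟩
  refine ⟨(0, -τ), iff_of_false ?_ ?_⟩
  · rw [hN₁]
    exact fun h => h01.1 h
  · rw [hN₀]
    simp only [Prod.mk_add_mk, add_zero, add_neg_cancel]
    rcases zmod_two_cases δ with rfl | rfl
    · simp only [true_and, h01, false_and, or_false]
      exact fun h => zmod_neg_one_ne_zero hn h.symm
    · simp only [h10, false_and, false_or, true_and, ne_eq, not_true_eq_false, not_false_eq_true]

/-- Atom B: `|N₀| = n`. [folklore] -/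
theorem atomB_card [NeZero n] {N₀ : Finset (ZMod 2 × ZMod n)}
    (hN₀ : ∀ x : ZMod 2 × ZMod n, x ∈ N₀ ↔ (x.1 = 0 ∧ x.2 = -1) ∨ (x.1 = 1 ∧ x.2 ≠ 0)) :
    N₀.card = n := by
  have h01 : ((0 : ZMod 2) = 1) ↔ False := by decide
  have h10 : ((1 : ZMod 2) = 0) ↔ False := by decide
  have hdec : N₀ = insert ((0 : ZMod 2), (-1 : ZMod n))
      ((Finset.univ.erase (0 : ZMod n)).image fun k => ((1 : ZMod 2), k)) := by
    ext ⟨j, k⟩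
    rw [hN₀, Finset.mem_insert, Finset.mem_image]
    rcases zmod_two_cases j with rfl | rfl
    · simp [h01]
    · simp [h10]
  have hnot : ((0 : ZMod 2), (-1 : ZMod n)) ∉ (Finset.univ.erase (0 : ZMod n)).image
      fun k => ((1 : ZMod 2), k) := by
    rw [Finset.mem_image]
    rintro ⟨k, -, hk⟩
    exact h10.1 (Prod.mk.inj hk).1
  rw [hdec, Finset.card_insert_of_notMem hnot, Finset.card_image_of_injective _ fun a b h => (Prod.mk.inj h).2,
    Finset.card_erase_of_mem (Finset.mem_univ _), Finset.card_univ, ZMod.card]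
  have : 1 ≤ n := Nat.pos_of_ne_zero (NeZero.ne n)
  omega

/-- Atom B: `|N₁| = n`. [folklore] -/
theorem atomB_card' [NeZero n] {N₁ : Finset (ZMod 2 × ZMod n)}
    (hN₁ : ∀ x : ZMod 2 × ZMod n, x ∈ N₁ ↔ x.1 = 1) : N₁.card = n := by
  have hdec : N₁ = Finset.univ.image fun k : ZMod n => ((1 : ZMod 2), k) := by
    ext ⟨j, k⟩
    rw [hN₁, Finset.mem_image]
    constructor
    · rintro rfl
      exact ⟨k, Finset.mem_univ _, rfl⟩
    · rintro ⟨k', -, hk⟩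
      exact (Prod.mk.inj hk).1.symm
  rw [hdec, Finset.card_image_of_injective _ fun a b h => (Prod.mk.inj h).2, Finset.card_univ, ZMod.card]

/-- A character of `ℤ/2 × (ℤ/2 × ℤ/n)` with `χ(0,(1,0)) = 1` and `χ(0,(0,1)) = 1` is trivial on `{0} × X`.
[folklore] -/
theorem atomB_trivial [NeZero n] (χ : AddChar (ZMod 2 × (ZMod 2 × ZMod n)) ℂ) (ht : χ (0, (1, 0)) = 1)
    (hu : χ (0, (0, 1)) = 1) (x : ZMod 2 × ZMod n) : χ (0, x) = 1 := by
  obtain ⟨j, k⟩ := x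
  rw [addChar_zero_mk_eq_of_apply_eq_one χ hu]
  rcases zmod_two_cases j with rfl | rfl
  · exact AddChar.map_zero_eq_one χ
  · exact ht

/-- **ATOM B.**  On `M = ℤ/2 × (ℤ/2 × ℤ/n)`, `n ≥ 3`, with `c₀ = (1, 0)`: CM sets `T₀ = T_{N₀}`, `T₁ = T_{N₁}` for
`c₀`, `T₀` with trivial stabiliser and not a translate of `T₁`, both killed by every character `χ` of `M` with
`χ(c₀) = −1` which is trivial on `X = ℤ/2 × ℤ/n` (balanced: Weil type over the fixed field of `X`).
[cite: Gordon1999HodgeAVSurvey, §9.4.3 (Theorem [B.140])] [cite: Shimura1998, §8.2 Prop. 26] -/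
theorem atomB (hn : 3 ≤ n) :
    ∃ T₀ T₁ : Finset (ZMod 2 × (ZMod 2 × ZMod n)),
      (∀ m, m ∈ T₀ ↔ (1, 0) + m ∉ T₀) ∧ (∀ m, m ∈ T₁ ↔ (1, 0) + m ∉ T₁) ∧
      (∀ v, v ≠ 0 → ∃ w, ¬ (w ∈ T₀ ↔ v + w ∈ T₀)) ∧ (∀ d, ∃ w, ¬ (w ∈ T₁ ↔ d + w ∈ T₀)) ∧
      ∀ χ : AddChar (ZMod 2 × (ZMod 2 × ZMod n)) ℂ, χ (1, 0) = -1 → χ (0, (1, 0)) = 1 →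
        χ (0, (0, 1)) = 1 → ∑ m ∈ T₀, χ m = 0 ∧ ∑ m ∈ T₁, χ m = 0 := by
  haveI : NeZero n := ⟨by omega⟩
  set N₀ : Finset (ZMod 2 × ZMod n) :=
    Finset.univ.filter fun x => (x.1 = 0 ∧ x.2 = -1) ∨ (x.1 = 1 ∧ x.2 ≠ 0) with hN₀_def
  set N₁ : Finset (ZMod 2 × ZMod n) := Finset.univ.filter fun x => x.1 = 1 with hN₁_def
  have hN₀ : ∀ x : ZMod 2 × ZMod n, x ∈ N₀ ↔ (x.1 = 0 ∧ x.2 = -1) ∨ (x.1 = 1 ∧ x.2 ≠ 0) := fun x => by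
    simp only [hN₀_def, Finset.mem_filter, Finset.mem_univ, true_and]
  have hN₁ : ∀ x : ZMod 2 × ZMod n, x ∈ N₁ ↔ x.1 = 1 := fun x => by
    simp only [hN₁_def, Finset.mem_filter, Finset.mem_univ, true_and]
  set T₀ : Finset (ZMod 2 × (ZMod 2 × ZMod n)) := Finset.univ.filter fun m => (m.1 = 1 ↔ m.2 ∈ N₀)
    with hT₀_def
  set T₁ : Finset (ZMod 2 × (ZMod 2 × ZMod n)) := Finset.univ.filter fun m => (m.1 = 1 ↔ m.2 ∈ N₁)
    with hT₁_def
  have hT₀ : ∀ m, m ∈ T₀ ↔ (m.1 = 1 ↔ m.2 ∈ N₀) := fun m => by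
    simp only [hT₀_def, Finset.mem_filter, Finset.mem_univ, true_and]
  have hT₁ : ∀ m, m ∈ T₁ ↔ (m.1 = 1 ↔ m.2 ∈ N₁) := fun m => by
    simp only [hT₁_def, Finset.mem_filter, Finset.mem_univ, true_and]
  have hcardX : Fintype.card (ZMod 2 × ZMod n) = 2 * n := by
    rw [Fintype.card_prod, ZMod.card, ZMod.card]
  refine ⟨T₀, T₁, signSet_cm hT₀, signSet_cm hT₁, signSet_prim hT₀ (atomB_ha hn hN₀) (atomB_hb hn hN₀),
    signSet_ntr hT₀ hT₁ (atomB_ha' hn hN₀ hN₁) (atomB_hb' hn hN₀ hN₁), fun χ hc ht hu => ⟨?_, ?_⟩⟩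
  · exact sum_signSet_eq_zero_of_trivial hT₀ χ hc (atomB_trivial χ ht hu) (by rw [atomB_card hN₀, hcardX])
  · exact sum_signSet_eq_zero_of_trivial hT₁ χ hc (atomB_trivial χ ht hu) (by rw [atomB_card' hN₁, hcardX])

end AtomB

end Summit.HodgeConjecture.CorCM.AbelianOddPart

end
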